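import Summits.ResolutionOfSingularities.ResolutionOfSingularities.Theorems.FrobeniusClosingPatchingRelPerfectDepthPhaseCCarrierGameLiftDictionary
import Summits.ResolutionOfSingularities.ResolutionOfSingularities.Theorems.FrobeniusClosingPatchingRelPerfectDepthPhaseCCarrierGameLiftPushforward
import Summits.ResolutionOfSingularities.ResolutionOfSingularities.Theorems.FrobeniusClosingPatchingRelPerfectMonomialRouteKWin
import Summits.ResolutionOfSingularities.ResolutionOfSingularities.Theorems.FrobeniusClosingPatchingRelPerfectDepthPhaseCLocalGlue
import Literature.AlgebraicGeometry.Resolution.KollarMaxContactPersistence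
import HarnessLib

/-!
# Crux `PatchingRelPerfect` (stmt-ResolutionOfSingularities-16161), chain W5.2 — F7(β) (β-AX) X3 C-I finish, CE1
# `…DepthPhaseCCarrierGameLift` (ASSEMBLY): THE LIFTED CARRIER GAME PRINCIPALISES `K` — and hence the `PhaseCOne` conclusion

[OURS · L1 W5.2 · res-L1-w52-plan-1 NOTE G11-40 (3) / G11-49 (2) / RULING G12-1 (7), res-L1-w52-idea-1 DECISION 18:58:04Z
«C-I := MONOMIAL PHASE → CARRIER → CE1» → res-D-pv-046; design of record `D/res-D-pv-046/DepthPhaseCCarrierGameLift.scratch.v2.lean`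
(P4); parts 1–3 = `…GameLiftWin` p556330, `…GameLiftDictionary` p556791, `…GameLiftPushforward`] Replaces the role of NO printed item;
NOT a statement of the manuscript under review; fact-free; any dimension.

THE INPUT (C-I END currency at a carrier, G11-47 (2) / A20 amended): a regular locally Noetherian `X` (in the chain: an open PATCH of
the ambient threefold containing the treated part of `cosupp K♭`), an ideal sheaf `K` (the residual `K♭`), a CARRIER `G ≤ K` which is a
regular hypersurface (order-one stalk generators), LETTERS `𝓛` on `Γ = V(G)` — a duplicate-free simple normal crossings list of ideal
sheaves of `Γ` (e.g. the prime divisor ideals of the boundary traces) — and exponent families `𝒦 ≠ []` on `𝓛` with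
`K|_Γ = Σ_{A ∈ 𝒦} 𝓛^A` (`monomialSum`). THE OUTPUT (END GLUE currency of RULING G11-51 (2), consumed by res-L1-w52-lead-1's
`MultiHostState.phaseCOne_conclusion_of_isEffectiveCartier` p557185 / `…_of_local` p557907): a multiple blow-up `t` of `X` with regular
centres over `cosupp K`, regular top, and `K𝒪_top` EFFECTIVE CARTIER.

THE PROOF: (1) Hironaka's polyhedra game with marking `1` is winnable from the initial state of `(𝓛, 𝒦)` (Route K, tree:
`PolyhedraGame.routeKTarget`); (2) the marking-one dictionary on `Γ` (part 2, `exists_isAdmissibleFor_of_winnablePos_one`) turns the win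
into a `CentreSeq` on `Γ` admissible for `(K|_Γ, 𝓛, 1)` whose final controlled transform is the unit ideal; (3) going up at multiplicity
one along `Γ ↪ X` (part 3, `CarrierGoingUp.isAdmissibleFor_pushforward_and_ideal_eq_top`, X-boundary `∅`, related sub-boundary `∅` —
the letters live only on the carrier and only STRENGTHEN admissibility there) gives Kollár's push-forward `j_* t` admissible for
`(K, ∅, 1)` with unit final transform; (4) `K𝒪_top = 𝓔 · 𝒪 = 𝓔`, the accumulated exceptional monomial, effective Cartier
(`CarrierGoingUp.exists_isEffectiveCartier_mul_transformMarked_ideal`).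

* **`carrierGameLift`** — the statement above.
* `MultiHostState.phaseCOne_conclusion_of_carrierGame` — CE1 plugged into the END GLUE (global carrier on `X`).
* `MultiHostState.phaseCOne_conclusion_of_local_carrierGame` — CE1 on an open patch `X₀ ⊇ cosupp K♭` plugged into the LOCAL END GLUE
  (integral regular Noetherian `X`).

HONEST CAVEAT: these theorems say nothing about WHEN a carrier with a letter presentation of `K♭|_Γ` exists (that is the C-I monomial
phase / carrier step of the chain, idea-1 memo-4 §31); they are the lift once it does. AI-written; AI review is weaker than expert review.

## References (for the mathematics; nothing here is a statement of the manuscript under review)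
* J. Kollár, *Lectures on Resolution of Singularities* (2007), 3.30.3, Cor. 3.85, 3.104 Step 2.2, (3.111) Step 3. [Kollar2007]
* E. Bierstone, D. Grigoriev, P. Milman, J. Włodarczyk, arXiv:1206.3090, Def. 3.1.3, Lemma 3.9.4. [BierstoneGrigorievMilmanWlodarczyk2011]
* M. Spivakovsky, *A solution to Hironaka's polyhedra game* (1983). [Spivakovsky1983]
-/

-- `Summit.<Summit>.<Sub>.Theorems` with `Sub = Summit` (single-conjunct summit, D-0017)
set_option linter.dupNamespace false

noncomputable section

open CategoryTheory AlgebraicGeometry TopologicalSpace IsLocalRing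
open Literature.AlgebraicGeometry.Resolution

namespace Summit.ResolutionOfSingularities.ResolutionOfSingularities.Theorems

namespace DepthMultiHost

open DepthTargets (monomialSum)
open MonomialCleanup (initialState initialState_wf gameInv_initialState exists_isAdmissibleFor_of_winnablePos_one)
open PolyhedraGame (WinnablePos routeKTarget winnablePos_of_routeKTarget)

universe u

/-- [OURS · L1 W5.2] **CE1 — THE LIFTED CARRIER GAME PRINCIPALISES `K`.** `X` regular locally Noetherian, `G ≤ K` ideal sheaves with
`V(G)` a regular hypersurface (order-one stalk generators), `𝓛` a duplicate-free simple normal crossings list on `Γ = V(G)`, `𝒦 ≠ []`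
exponent families on `𝓛` with `K|_Γ = Σ_{A ∈ 𝒦} 𝓛^A`: then some multiple blow-up of `X` with regular centres over `cosupp K` and
regular top makes `K𝒪_top` an effective Cartier divisor (indeed the push-forward of the marking-one game sequence on `Γ` has unit
controlled transform, and `K𝒪_top` is its exceptional monomial). [cite: Kollar2007, Cor. 3.85, 3.104 Step 2.2, (3.111) Step 3]
[cite: BierstoneGrigorievMilmanWlodarczyk2011, Lemma 3.9.4] -/
theorem carrierGameLift {X : Scheme.{u}} [IsLocallyNoetherian X] (hX : Scheme.IsRegular X)
    {K G : X.IdealSheafData} (hGK : G ≤ K)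
    (hGhyp : ∀ x ∈ G.support, ∃ v : X.presheaf.stalk x,
      stalkIdeal G x = Ideal.span {v} ∧ v ∉ (maximalIdeal (X.presheaf.stalk x)) ^ 2)
    (𝓛 : List G.subscheme.IdealSheafData) (h𝓛 : HasSNC 𝓛) (h𝓛nd : 𝓛.Nodup)
    (𝒦 : List (List (G.subscheme.IdealSheafData × ℕ))) (hbd : ∀ A ∈ 𝒦, boundaryOf A = 𝓛) (h𝒦 : 𝒦 ≠ [])
    (hJ : K.comap G.subschemeι = monomialSum 𝒦) :
    ∃ t : CentreSeq X, t.AllRegular ∧ t.CentresOver (K.support : Set X) ∧ Scheme.IsRegular t.top ∧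
      IsEffectiveCartier (K.comap t.comp) := by
  classical
  haveI : IsLocallyNoetherian G.subscheme := LocallyOfFiniteType.isLocallyNoetherian G.subschemeι
  -- (1) the win of the marking-one polyhedra game from the initial state of `(𝓛, 𝒦)` (Route K)
  have hw : WinnablePos 1 (initialState 𝓛.length 𝒦) :=
    winnablePos_of_routeKTarget (routeKTarget le_rfl) _ (initialState_wf 𝓛.length h𝒦) 𝓛.length rfl
  -- (2) the marking-one dictionary on the carrier
  obtain ⟨t, hadm, -, htop⟩ :=
    exists_isAdmissibleFor_of_winnablePos_one hw G.subscheme 𝓛 𝒦 id (gameInv_initialState h𝓛 h𝓛nd hbd)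
  -- (3) going up along the carrier embedding, X-boundary `[]`, related sub-boundary `[]`
  have hker : G.subschemeι.ker = G := Scheme.IdealSheafData.ker_subschemeι G
  have hH : ∀ x ∈ G.subschemeι.ker.support, ∃ v : X.presheaf.stalk x,
      stalkIdeal G.subschemeι.ker x = Ideal.span {v} ∧ v ∉ (maximalIdeal (X.presheaf.stalk x)) ^ 2 := by
    rw [hker]; exact hGhyp
  have hB : ∃ BS' : List G.subscheme.IdealSheafData,
      BS'.Sublist (⟨monomialSum 𝒦, 𝓛, 1⟩ : MarkedIdeal G.subscheme).boundary ∧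
        BoundaryRel G.subschemeι (⟨K, [], 1⟩ : MarkedIdeal X).boundary BS' :=
    ⟨[], List.nil_sublist _, boundaryRel_subschemeι G [] (hasSNC_singleton_of_generator hX hGhyp)⟩
  obtain ⟨hadmX, hregX, htopX⟩ := CarrierGoingUp.isAdmissibleFor_pushforward_and_ideal_eq_top t G.subschemeι
    ⟨K, [], 1⟩ ⟨monomialSum 𝒦, 𝓛, 1⟩ hX hH hJ.symm rfl rfl hB (by rw [hker]; exact hGK) hadm htop
  -- (4) the accumulated exceptional monomial
  obtain ⟨E, hE, hEq⟩ := CarrierGoingUp.exists_isEffectiveCartier_mul_transformMarked_ideal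
    (t.pushforward G.subschemeι) ⟨K, [], 1⟩ hadmX
  refine ⟨t.pushforward G.subschemeι, CentreSeq.IsAdmissibleFor.allRegular _ _ hadmX,
    CentreSeq.IsAdmissibleFor.centresOver _ _ hadmX le_rfl, hregX, ?_⟩
  have hKE : K.comap (t.pushforward G.subschemeι).comp = E := by
    rw [htopX, ← Scheme.IdealSheafData.one_eq_top, mul_one] at hEq
    exact hEq
  rw [hKE]
  exact hE

/-- [OURS · L1 W5.2] **CE1 ⇒ THE `PhaseCOne` CONCLUSION (global carrier).** For a state `S₁` with a summand on regular Noetherian `X`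
whose residual `K♭ = S₁.residual.K` carries a carrier `G ≤ K♭` with a letter presentation of `K♭|_{V(G)}` as in `carrierGameLift`:
the `PhaseCOne` conclusion of RULING G11-36 holds for `S₁` (CE1 fed to res-L1-w52-lead-1's END GLUE
`phaseCOne_conclusion_of_isEffectiveCartier`). [cite: Kollar2007, (3.111) Step 3] -/
theorem MultiHostState.phaseCOne_conclusion_of_carrierGame {X : Scheme.{u}} [IsNoetherian X] (hX : Scheme.IsRegular X)
    (S₁ : MultiHostState X) (hn : S₁.n ≠ 0) {G : X.IdealSheafData} (hGK : G ≤ S₁.residual.K)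
    (hGhyp : ∀ x ∈ G.support, ∃ v : X.presheaf.stalk x,
      stalkIdeal G x = Ideal.span {v} ∧ v ∉ (maximalIdeal (X.presheaf.stalk x)) ^ 2)
    (𝓛 : List G.subscheme.IdealSheafData) (h𝓛 : HasSNC 𝓛) (h𝓛nd : 𝓛.Nodup)
    (𝒦 : List (List (G.subscheme.IdealSheafData × ℕ))) (hbd : ∀ A ∈ 𝒦, boundaryOf A = 𝓛) (h𝒦 : 𝒦 ≠ [])
    (hJ : S₁.residual.K.comap G.subschemeι = monomialSum 𝒦) :
    ∃ (s : CentreSeq X), s.AllRegular ∧ s.CentresOver (S₁.K.support : Set X) ∧ Scheme.IsRegular s.top ∧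
      ∃ (_ : IsNoetherian s.top) (M : s.top.IdealSheafData) (S₂ : MultiHostState s.top),
        S₁.K.comap s.comp = M * S₂.K ∧ IsEffectiveCartier M ∧ S₂.n ≠ 0 ∧
        ∃ (U : s.top.Opens), S₂.residual.IsEndOn U := by
  obtain ⟨t, htreg, htover, httop, hE⟩ := carrierGameLift hX hGK hGhyp 𝓛 h𝓛 h𝓛nd 𝒦 hbd h𝒦 hJ
  exact S₁.phaseCOne_conclusion_of_isEffectiveCartier hn t htreg htover httop hE

/-- [OURS · L1 W5.2] **CE1 ON A PATCH ⇒ THE `PhaseCOne` CONCLUSION (RULING G11-51 (5) / G12-1 (7): carriers are pole-local).** `X`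
regular Noetherian integral, `S₁` a state with a summand and non-zero residual `K♭`, `j : X₀ ⟶ X` an open immersion with
`cosupp K♭ ⊆ j(X₀)`, and ON THE PATCH a carrier `G₀ ≤ K♭|_{X₀}` with a letter presentation of `K♭|_{V(G₀)}` as in `carrierGameLift`:
the `PhaseCOne` conclusion holds for `S₁` (CE1 on `X₀`, then res-L1-w52-lead-1's LOCAL END GLUE `phaseCOne_conclusion_of_local`).
[cite: Kollar2007, (3.111) Step 3] [cite: GortzWedhorn2020, Prop. 13.91 (1)–(2)] -/
theorem MultiHostState.phaseCOne_conclusion_of_local_carrierGame {X X₀ : Scheme.{u}} [IsNoetherian X] [IsIntegral X]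
    (hX : Scheme.IsRegular X) (S₁ : MultiHostState X) (hn : S₁.n ≠ 0) (hK0 : S₁.residual.K ≠ ⊥)
    (j : X₀ ⟶ X) [IsOpenImmersion j] (hZj : (S₁.residual.K.support : Set X) ⊆ Set.range j.base)
    {G₀ : X₀.IdealSheafData} (hGK : G₀ ≤ S₁.residual.K.comap j)
    (hGhyp : ∀ x ∈ G₀.support, ∃ v : X₀.presheaf.stalk x,
      stalkIdeal G₀ x = Ideal.span {v} ∧ v ∉ (maximalIdeal (X₀.presheaf.stalk x)) ^ 2)
    (𝓛 : List G₀.subscheme.IdealSheafData) (h𝓛 : HasSNC 𝓛) (h𝓛nd : 𝓛.Nodup)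
    (𝒦 : List (List (G₀.subscheme.IdealSheafData × ℕ))) (hbd : ∀ A ∈ 𝒦, boundaryOf A = 𝓛) (h𝒦 : 𝒦 ≠ [])
    (hJ : (S₁.residual.K.comap j).comap G₀.subschemeι = monomialSum 𝒦) :
    ∃ (s : CentreSeq X), s.AllRegular ∧ s.CentresOver (S₁.K.support : Set X) ∧ Scheme.IsRegular s.top ∧
      ∃ (_ : IsNoetherian s.top) (M : s.top.IdealSheafData) (S₂ : MultiHostState s.top),
        S₁.K.comap s.comp = M * S₂.K ∧ IsEffectiveCartier M ∧ S₂.n ≠ 0 ∧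
        ∃ (U : s.top.Opens), S₂.residual.IsEndOn U := by
  haveI : IsLocallyNoetherian X₀ := LocallyOfFiniteType.isLocallyNoetherian j
  have hX₀ : Scheme.IsRegular X₀ := Scheme.IsRegular.of_isOpenImmersion j hX
  obtain ⟨t₀, h₀reg, h₀over, -, hE⟩ := carrierGameLift hX₀ hGK hGhyp 𝓛 h𝓛 h𝓛nd 𝒦 hbd h𝒦 hJ
  refine S₁.phaseCOne_conclusion_of_local hX hn hK0 j hZj t₀ h₀reg ?_ hE.isLocallyPrincipal
  rw [Scheme.IdealSheafData.support_comap] at h₀over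
  exact h₀over

end DepthMultiHost

end Summit.ResolutionOfSingularities.ResolutionOfSingularities.Theorems

end
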